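import Literature.NumberTheory.ModularForms.RademacherPhiCompositionProofs
import HarnessLib

/-!
# Dedekind sums: complements (reciprocity for signed coprime integers, `s(1,k)`, periodicity mod `|c|`)

Topic `Literature/NumberTheory/ModularForms`; namespace `Literature.NumberTheory.ModularForms`.
Theorem-only complements to `DedekindSumRademacherPhi` / `DedekindSumReciprocity` /
`RademacherPhiCompositionProofs` (no definitions, no named facts):

* `dedekindSum_add_mul_natAbs` — `s(d + ce, |c|) = s(d, |c|)` [cite: Apostol1990, Thm. 3.6(a)];
* `dedekindSum_reciprocity_int` — the reciprocity law for a coprime pair of NONZERO INTEGERS `c, d`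
  in the signed form `12·sign(d)·s(c,|d|) + 12·sign(c)·s(d,|c|) = (1 + c² + d²)/(cd) − 3·sign(c)sign(d)`
  (the form in which it enters Rademacher's `Φ`; [cite: RademacherGrosswald1972, Ch. 4 A, pp. 47–48]);
* `twelve_mul_dedekindSum_one`, `dedekindSum_one_left` — `s(1,k) = (k−1)(k−2)/(12k)`
  [cite: Apostol1990, §3.7 (display after Thm. 3.6)] [cite: RademacherGrosswald1972, Ch. 2 Lemma 2].

## References

* [Apostol1990] T. M. Apostol, *Modular Functions and Dirichlet Series in Number Theory*, 2nd ed.,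
  GTM 41 (1990), §3.7, Thm. 3.6, Thm. 3.7.
* [RademacherGrosswald1972] H. Rademacher, E. Grosswald, *Dedekind Sums*, Carus Math. Monographs 16
  (1972), Ch. 2 Lemma 2, Ch. 4 A.
-/

open scoped MatrixGroups

namespace Literature.NumberTheory.ModularForms

/-- `s(d + ce, |c|) = s(d, |c|)` (periodicity in the first argument modulo `|c|`).
[cite: Apostol1990, Thm. 3.6(a)] -/
theorem dedekindSum_add_mul_natAbs (d c e : ℤ) :
    dedekindSum (d + c * e) c.natAbs = dedekindSum d c.natAbs := by
  apply dedekindSum_congr_of_emod_eq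
  set k : ℕ := c.natAbs with hk
  obtain ⟨u, hu⟩ : (k : ℤ) ∣ c := by rw [hk]; exact Int.natAbs_dvd.mpr (dvd_refl c)
  rw [show d + c * e = d + (k : ℤ) * (u * e) by rw [hu]; ring, Int.add_mul_emod_self_left]

/-- The reciprocity law for a coprime pair of NONZERO INTEGERS `c, d`, in the form used for `Φ`:
`12·sign(d)·s(c,|d|) + 12·sign(c)·s(d,|c|) = (1 + c² + d²)/(cd) − 3·sign(c)·sign(d)`.
[cite: RademacherGrosswald1972, Ch. 4 A (pp. 47–48, derivation of (4) from (57b))] -/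
theorem dedekindSum_reciprocity_int {c d : ℤ} (hc : c ≠ 0) (hd : d ≠ 0) (hcop : IsCoprime c d) :
    12 * (Int.sign d : ℚ) * dedekindSum c d.natAbs + 12 * (Int.sign c : ℚ) * dedekindSum d c.natAbs =
      (1 + (c : ℚ) ^ 2 + (d : ℚ) ^ 2) / (c * d) - 3 * (Int.sign c : ℚ) * Int.sign d := by
  have hγ0 : 0 < c.natAbs := Int.natAbs_pos.mpr hc
  have hκ0 : 0 < d.natAbs := Int.natAbs_pos.mpr hd
  have hcopn : Nat.Coprime c.natAbs d.natAbs := Int.isCoprime_iff_gcd_eq_one.mp hcop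
  have R := dedekindSum_reciprocity hγ0 hκ0 hcopn
  rw [dedekindSum_eq_sign_mul_natAbs c, dedekindSum_eq_sign_mul_natAbs d]
  simp only [Int.natCast_natAbs] at R ⊢
  have hcq : (c : ℚ) ≠ 0 := by exact_mod_cast hc
  have hdq : (d : ℚ) ≠ 0 := by exact_mod_cast hd
  have eγ : ((c.natAbs : ℕ) : ℚ) = |(c : ℚ)| := by
    rw [← Int.cast_natCast (R := ℚ), Int.natCast_natAbs, Int.cast_abs]
  have eκ : ((d.natAbs : ℕ) : ℚ) = |(d : ℚ)| := by
    rw [← Int.cast_natCast (R := ℚ), Int.natCast_natAbs, Int.cast_abs]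
  rw [eγ, eκ] at R
  rcases lt_or_gt_of_ne hc with hcn | hcp <;> rcases lt_or_gt_of_ne hd with hdn | hdp
  · rw [abs_of_neg (by exact_mod_cast hcn : (c : ℚ) < 0),
      abs_of_neg (by exact_mod_cast hdn : (d : ℚ) < 0)] at R
    rw [Int.sign_eq_neg_one_of_neg hcn, Int.sign_eq_neg_one_of_neg hdn]
    push_cast
    field_simp
    linear_combination R
  · rw [abs_of_neg (by exact_mod_cast hcn : (c : ℚ) < 0),
      abs_of_pos (by exact_mod_cast hdp : (0 : ℚ) < d)] at R
    rw [Int.sign_eq_neg_one_of_neg hcn, Int.sign_eq_one_of_pos hdp]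
    push_cast
    field_simp
    linear_combination R
  · rw [abs_of_pos (by exact_mod_cast hcp : (0 : ℚ) < c),
      abs_of_neg (by exact_mod_cast hdn : (d : ℚ) < 0)] at R
    rw [Int.sign_eq_one_of_pos hcp, Int.sign_eq_neg_one_of_neg hdn]
    push_cast
    field_simp
    linear_combination R
  · rw [abs_of_pos (by exact_mod_cast hcp : (0 : ℚ) < c),
      abs_of_pos (by exact_mod_cast hdp : (0 : ℚ) < d)] at R
    rw [Int.sign_eq_one_of_pos hcp, Int.sign_eq_one_of_pos hdp]
    push_cast
    field_simp
    linear_combination R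

/-! ### Complement: the closed form of `s(1, k)` -/

/-- `s(1,k) = (k−1)(k−2)/(12k)`, i.e. `12k·s(1,k) = (k−1)(k−2)` (`= −1/4 + 1/(6k) + k/12` in RG's form).
[cite: Apostol1990, §3.7 (display after Thm. 3.6)] [cite: RademacherGrosswald1972, Ch. 2 Lemma 2, eq. (5)] -/
theorem twelve_mul_dedekindSum_one (k : ℕ) (hk : 0 < k) :
    12 * (k : ℚ) * dedekindSum 1 k = ((k : ℚ) - 1) * ((k : ℚ) - 2) := by
  have h := twelve_mul_dedekindSum (h := 1) hk (Nat.coprime_one_left k)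
  have hA : ∑ r ∈ Finset.range k, (r : ℚ) * ((1 * r / k : ℕ) : ℚ) = 0 := by
    refine Finset.sum_eq_zero fun r hr => ?_
    rw [one_mul, Nat.div_eq_of_lt (Finset.mem_range.mp hr)]
    simp
  push_cast at h
  rw [hA] at h
  linear_combination h

/-- `s(1,k) = (k−1)(k−2)/(12k)` for `k ≥ 1`. [cite: Apostol1990, §3.7 (display after Thm. 3.6)] -/
theorem dedekindSum_one_left {k : ℕ} (hk : 0 < k) :
    dedekindSum 1 k = ((k : ℚ) - 1) * ((k : ℚ) - 2) / (12 * k) := by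
  have hk' : (k : ℚ) ≠ 0 := by exact_mod_cast hk.ne'
  rw [eq_div_iff (by positivity)]
  linear_combination twelve_mul_dedekindSum_one k hk

end Literature.NumberTheory.ModularForms
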